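import Mathlib
import HarnessLib
import Summits.HubbardSuperconductivity.HubbardSuperconductivity.Theorems.KLProgrammeKLRegimeEngineScaleCutoffDecay

/-!
# KL programme — VL lane (keying (A′), file (1c) part 3): THE `L¹` NORM OF THE FRAME-`K` ULTRAVIOLET COVARIANCE ON THE `2M` TIME LATTICE at a generic cutoff index `d`
# (`Λ_d = klScale klE0 d`), for admissible frames, uniform in `M ≥ β³`, `L`, `μ`, `U` — the datum `ρ` (resp. `ε·ρ`) of `…TwoVolumeDualRowsLastScaleFourier`
# (cell gate-hubbard-kl, seat hubbard-kl-k3c4-p1 g27)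

The `2M`-LATTICE twin of p3's `…EngineScaleCutoffDecay` (which reads the Literature decay constant on the `2(2M)`-point grid): the Literature lemma
`sum_sum_norm_charSum_gridSymbol_uvSymbolCT_le` is stated for every `N ≥ 2M`, and at `N = 2M` its LHS is exactly the `ℓ¹` norm of the `2M`-lattice character sum of the padded
grid symbol — the quantity `ρ` through which the last-scale frame conversion of the VL dual rows is priced (`…TwoVolumeFrameConversionRowsFourier`).  Same radicand algebra
(`ScaleZeroDecay.radicand_scaleZero_eq` at `N′ = 2M`, time rate `s₀ = βΛ_d/(2M)`; `2β/(2M) ≤ 1/2` and the edge term `β⁵Λ_d⁴/(4π²(2M−3)²) ≤ 1` from `β³ ≤ M`, `β ≥ 128`, `Λ_d ≤ 1`):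

* `charSum_gridSymbol_twoM_le_of_frameOK` — explicit in `β, L, M, s₀, B₁, B₂` (line bound `D = 7` from `FrameOK`);
* **`eps_mul_charSum_gridSymbol_twoM_le`** — `(β/(2M))·ρ-LHS ≤ 14·√((1/2 + 12/Λ_d)(2/Λ_d + 128π⁴K₂²/Λ_d + 2π⁵K₂²/Λ_d² + 1 + π⁴K_x²/Λ_d³))`, `K₂ = 4B₂+6B₁+2`,
  `K_x = 7²K₂(2/Λ_d) + 7(2B₁+1)`;
* `eps_mul_charSum_gridSymbol_twoM_le_A1` — at the tree's cutoff-derivative bounds `B₁ = 32/3`, `B₂ = 1110`.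

LEDGER NOTE.  This is scale-`0` technology read at `Λ_d`: the bound is `∝ Λ_d^{-3}` (through `K_x ∝ Λ_d^{-1}` and the `Λ_d^{-3}` of the space second difference), so at the VL reading
scale `Λ_{nScales β+1} ≍ 1/β` it is a `β³`-class constant — a crude but unconditional placeholder for the `β`-dependent conversion constant; the sharp value (sector counting,
BGM 2006 (2.33)) is `≍ β^{3/2}`.  Everything is proved; no definitions, no named facts.
References: de Siqueira Pedra–Salmhofer 2008 §4 Cor. 4.4; BGM 2006 §2.8 (2.80)–(2.81) [cite: BenfattoGiulianiMastropietro2006].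
-/

noncomputable section

namespace Summit.HubbardSuperconductivity.HubbardSuperconductivity.Theorems.ScaleZeroDecay

set_option linter.dupNamespace false -- summit = problem name (single-conjunct summit), D-0017

open Real Finset Literature.MathematicalPhysics.QuantumLattice Literature.Probability.LatticeModels
open Literature.MathematicalPhysics.QuantumLattice.FermiRG
open Summit.HubbardSuperconductivity.HubbardSuperconductivity.Theorems.KLRegimeSplit
open Summit.HubbardSuperconductivity.HubbardSuperconductivity.Theorems.KLProgrammeLegKernels
open Summit.HubbardSuperconductivity.HubbardSuperconductivity.Theorems.DispersionFlow
open Summit.HubbardSuperconductivity.HubbardSuperconductivity.Theorems.EngineV8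

variable {R : RenConsts} {U : ℝ} {Nsc : ℕ} {μ : ℝ} {K : TrigPolyC4v} {β : ℝ} {B₁ B₂ : ℝ} {L M : ℕ} [NeZero L] [NeZero M] (d : ℕ)

/-- **The `2M`-lattice character sum of the frame-`K` UV symbol at `Λ_d`, explicit**: for an admissible frame (`D = 7`), `klBetaMin ≤ β`, `2 ≤ M`, any time rate `s₀ > 0` and
cutoff-derivative bounds `B₁, B₂`, the LHS of Literature `sum_sum_norm_charSum_gridSymbol_uvSymbolCT_le` at `N = 2M` is `≤ √((2+12/s₀)·14²)·√(2M·L²·[ℓ²-terms at Λ_d])`.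
[cite: BenfattoGiulianiMastropietro2006, §2.8 (2.80)–(2.81)] -/
theorem charSum_gridSymbol_twoM_le_of_frameOK (hK : FrameOK R U Nsc μ K) (hβ : klBetaMin ≤ β)
    (hB₁ : ∀ x, |deriv salmhoferCutoff x| ≤ B₁) (hB₂ : ∀ x, |deriv (deriv salmhoferCutoff) x| ≤ B₂) (hM : 2 ≤ M)
    {s₀ : ℝ} (hs₀ : 0 < s₀) (σ : Fin 2) :
    ∑ a : TorusSite 1 (2 * M), ∑ bv : TorusSite 2 L,
        ‖∑ q₀ : TorusSite 1 (2 * M), ∑ qv : TorusSite 2 L, torusChar q₀ a * torusChar qv bv *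
          gridSymbol L M (2 * M) β (uvSymbolCT L M β μ K (klScale klE0 d)) σ q₀ qv‖ ≤
      Real.sqrt ((2 + 12 / s₀) * 14 ^ 2) *
        Real.sqrt ((((2 * M : ℕ) : ℝ)) ^ 1 * (L : ℝ) ^ 2 *
          ((L : ℝ) ^ 2 * ((1 / (β * (L : ℝ) ^ 2)) ^ 2 * (2 * β / klScale klE0 d)) +
            ((((2 * M : ℕ) : ℝ)) * s₀ / 4) ^ 4 *
              ((L : ℝ) ^ 2 * ((1 / (β * (L : ℝ) ^ 2)) ^ 2 * (2 * Real.pi / β) ^ 4 * (4 * B₂ + 6 * B₁ + 2) ^ 2 *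
                  (64 * ((2 / klScale klE0 d) ^ 4 * (2 * β / klScale klE0 d)) + (2 / klScale klE0 d) ^ 6 * (64 * Real.pi))) +
                4 * ((L : ℝ) ^ 2 * (4 * ((1 / (β * (L : ℝ) ^ 2)) ^ 2 * ((β * (L : ℝ) ^ 2) * (β / (Real.pi * (2 * M - 3)))))) ^ 2)) +
            2 * (((L : ℝ) / 4) ^ 4 *
              ((L : ℝ) ^ 2 * ((1 / (β * (L : ℝ) ^ 2)) ^ 2 * (2 * Real.pi / L) ^ 4 *
                ((7 : ℝ) ^ 2 * (4 * B₂ + 6 * B₁ + 2) * (2 / klScale klE0 d) + 7 * (2 * B₁ + 1)) ^ 2 *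
                  ((2 / klScale klE0 d) ^ (2 * 1) * (2 * β / klScale klE0 d))))))) :=
  sum_sum_norm_charSum_gridSymbol_uvSymbolCT_le (N := 2 * M) (beta_pos_of_klBetaMin_le hβ) (klth_klScale_pos d) hB₁ hB₂ (by norm_num)
    (uvLineBound_of_frameOK hK) hM le_rfl hs₀ σ
set_option maxHeartbeats 400000 in
/-- **`ε·ρ` IS UNIFORM IN `M ≥ β³`**: for an admissible frame, `klBetaMin ≤ β`, `β³ ≤ M`,
`(β/(2M))·Σ_z‖Σ_q χ_q(z)·gridSymbol_{2M}(Ψ^K_{Λ_d})(q)‖ ≤ 14·√((1/2 + 12/Λ_d)(2/Λ_d + 128π⁴K₂²/Λ_d + 2π⁵K₂²/Λ_d² + 1 + π⁴K_x²/Λ_d³))`,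
`K₂ = 4B₂+6B₁+2`, `K_x = 7²K₂·(2/Λ_d) + 7(2B₁+1)` — the `L¹(dτ·Σ_x⃗)` norm of the frame-`K` covariance above `Λ_d` on the `2M` lattice, uniformly in `M`, `L`, `μ`, `U`, the frame.
[cite: PedraSalmhofer2008, §4 Cor. 4.4] -/
theorem eps_mul_charSum_gridSymbol_twoM_le (hK : FrameOK R U Nsc μ K) (hβ : klBetaMin ≤ β)
    (hB₁ : ∀ x, |deriv salmhoferCutoff x| ≤ B₁) (hB₂ : ∀ x, |deriv (deriv salmhoferCutoff) x| ≤ B₂) (hβM : β ^ 3 ≤ (M : ℝ)) (σ : Fin 2) :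
    imagTimeWeight β M * ∑ a : TorusSite 1 (2 * M), ∑ bv : TorusSite 2 L,
        ‖∑ q₀ : TorusSite 1 (2 * M), ∑ qv : TorusSite 2 L, torusChar q₀ a * torusChar qv bv *
          gridSymbol L M (2 * M) β (uvSymbolCT L M β μ K (klScale klE0 d)) σ q₀ qv‖ ≤
      14 * Real.sqrt ((1 / 2 + 12 / klScale klE0 d) *
        (2 / klScale klE0 d + 128 * Real.pi ^ 4 * (4 * B₂ + 6 * B₁ + 2) ^ 2 / klScale klE0 d + 2 * Real.pi ^ 5 * (4 * B₂ + 6 * B₁ + 2) ^ 2 / klScale klE0 d ^ 2 + 1 +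
          Real.pi ^ 4 * ((7 : ℝ) ^ 2 * (4 * B₂ + 6 * B₁ + 2) * (2 / klScale klE0 d) + 7 * (2 * B₁ + 1)) ^ 2 / klScale klE0 d ^ 3)) := by
  have hβ0 : 0 < β := beta_pos_of_klBetaMin_le hβ
  have hβ128 : (128 : ℝ) ≤ β := by simpa [klBetaMin] using hβ
  have hΛ : (0 : ℝ) < klScale klE0 d := klth_klScale_pos d
  have hL : (0 : ℝ) < L := by exact_mod_cast Nat.pos_of_ne_zero (NeZero.ne L)
  have hβ3 : 2 * β ≤ β ^ 3 := by nlinarith [sq_nonneg β]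
  have hMr : 2 * β ≤ (M : ℝ) := hβ3.trans hβM
  have hM2 : 2 ≤ M := by
    have : (2 : ℝ) ≤ M := by linarith
    exact_mod_cast this
  have hM3 : (3 : ℝ) ≤ M := by linarith
  have hN2 : (((2 * M : ℕ) : ℝ)) = 2 * M := by push_cast; ring
  have hN0 : 0 < (((2 * M : ℕ) : ℝ)) := by rw [hN2]; positivity
  have hs₀pos : 0 < β * klScale klE0 d / (((2 * M : ℕ) : ℝ)) := by positivity
  have hrow := charSum_gridSymbol_twoM_le_of_frameOK (L := L) d hK hβ hB₁ hB₂ hM2 hs₀pos σ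
  have hε : imagTimeWeight β M = β / (((2 * M : ℕ) : ℝ)) := by rw [imagTimeWeight, hN2]
  rw [hε]
  refine mul_le_fourteen_sqrt_of_le hrow (by positivity) (by positivity) ?_
  rw [radicand_scaleZero_eq hN0.ne' hL.ne' hβ0.ne' hΛ.ne' (by linarith)]
  refine mul_le_mul_of_nonneg_left ?_ (by norm_num)
  have hB10 : 0 ≤ B₁ := (abs_nonneg _).trans (hB₁ 0)
  have hB20 : 0 ≤ B₂ := (abs_nonneg _).trans (hB₂ 0)
  have h1 : 2 * β / (((2 * M : ℕ) : ℝ)) + 12 / klScale klE0 d ≤ 1 / 2 + 12 / klScale klE0 d := by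
    have : 2 * β / (((2 * M : ℕ) : ℝ)) ≤ 1 / 2 := by rw [div_le_iff₀ hN0, hN2]; linarith
    linarith
  have hT3 : 256 * Real.pi ^ 5 * (4 * B₂ + 6 * B₁ + 2) ^ 2 / (β * klScale klE0 d ^ 2) ≤
      2 * Real.pi ^ 5 * (4 * B₂ + 6 * B₁ + 2) ^ 2 / klScale klE0 d ^ 2 := by
    rw [div_le_div_iff₀ (by positivity) (by positivity)]
    have : 0 ≤ Real.pi ^ 5 * (4 * B₂ + 6 * B₁ + 2) ^ 2 * klScale klE0 d ^ 2 := by positivity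
    nlinarith
  have hT4 : β ^ 5 * klScale klE0 d ^ 4 / (4 * Real.pi ^ 2 * (2 * M - 3) ^ 2) ≤ 1 := by
    have hβ3' : β ≤ β ^ 3 := by nlinarith [sq_nonneg β]
    have hM' : β ^ 3 ≤ 2 * (M : ℝ) - 3 := by linarith [hβ3'.trans hβM]
    have h6 : (β ^ 3) ^ 2 ≤ (2 * (M : ℝ) - 3) ^ 2 := pow_le_pow_left₀ (by positivity) hM' 2
    have hπ2 : 9 ≤ Real.pi ^ 2 := by nlinarith [Real.pi_gt_three]
    have hden : (0 : ℝ) < 4 * Real.pi ^ 2 * (2 * M - 3) ^ 2 := by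
      have : (0 : ℝ) < 2 * M - 3 := by linarith
      positivity
    rw [div_le_one hden]
    have hβ5 : β ^ 5 ≤ (β ^ 3) ^ 2 := by
      rw [← pow_mul, show 3 * 2 = 5 + 1 from rfl, pow_succ]
      exact le_mul_of_one_le_right (by positivity) (by linarith)
    have hΛ4 : β ^ 5 * klScale klE0 d ^ 4 ≤ β ^ 5 := mul_le_of_le_one_right (by positivity) (klScale_klE0_pow_four_le_one d)
    nlinarith [pow_pos hβ0 5]
  have hpos : 0 ≤ 2 / klScale klE0 d + 128 * Real.pi ^ 4 * (4 * B₂ + 6 * B₁ + 2) ^ 2 / klScale klE0 d +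
      256 * Real.pi ^ 5 * (4 * B₂ + 6 * B₁ + 2) ^ 2 / (β * klScale klE0 d ^ 2) + β ^ 5 * klScale klE0 d ^ 4 / (4 * Real.pi ^ 2 * (2 * M - 3) ^ 2) +
      Real.pi ^ 4 * ((7 : ℝ) ^ 2 * (4 * B₂ + 6 * B₁ + 2) * (2 / klScale klE0 d) + 7 * (2 * B₁ + 1)) ^ 2 / klScale klE0 d ^ 3 := by
    have : (0 : ℝ) < 2 * M - 3 := by linarith
    positivity
  refine mul_le_mul h1 ?_ hpos (by positivity)
  linarith

/-- **At the tree's cutoff bounds** (`B₁ = 32/3`, `B₂ = 1110`): `ε·ρ ≤ 14·√Q_d` with the radicand written out. -/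
theorem eps_mul_charSum_gridSymbol_twoM_le_A1 (hK : FrameOK R U Nsc μ K) (hβ : klBetaMin ≤ β) (hβM : β ^ 3 ≤ (M : ℝ)) (σ : Fin 2) :
    imagTimeWeight β M * ∑ a : TorusSite 1 (2 * M), ∑ bv : TorusSite 2 L,
        ‖∑ q₀ : TorusSite 1 (2 * M), ∑ qv : TorusSite 2 L, torusChar q₀ a * torusChar qv bv *
          gridSymbol L M (2 * M) β (uvSymbolCT L M β μ K (klScale klE0 d)) σ q₀ qv‖ ≤
      14 * Real.sqrt ((1 / 2 + 12 / klScale klE0 d) *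
        (2 / klScale klE0 d + 128 * Real.pi ^ 4 * (4 * (1110 : ℝ) + 6 * (32 / 3) + 2) ^ 2 / klScale klE0 d +
          2 * Real.pi ^ 5 * (4 * (1110 : ℝ) + 6 * (32 / 3) + 2) ^ 2 / klScale klE0 d ^ 2 + 1 +
          Real.pi ^ 4 * ((7 : ℝ) ^ 2 * (4 * (1110 : ℝ) + 6 * (32 / 3) + 2) * (2 / klScale klE0 d) + 7 * (2 * (32 / 3) + 1)) ^ 2 /
            klScale klE0 d ^ 3)) :=
  eps_mul_charSum_gridSymbol_twoM_le (L := L) d hK hβ klsv_B₁ klsv_B₂ hβM σ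

end Summit.HubbardSuperconductivity.HubbardSuperconductivity.Theorems.ScaleZeroDecay

end
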